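import Mathlib
import HarnessLib
import Literature.Analysis.FluidPDE.WholeSpaceIBP
import Literature.Analysis.FluidPDE.PineauVicolEnstrophy
import Literature.Analysis.FluidPDE.LerayHopfProofs

/-!
# The polynomial weight `ρ_σ = (1 + |x|²/σ²)⁻²` and the weighted integration-by-parts inequality

Seat ns-poloidal-K2-p2 g6 (interim lead-of-record on crux K2 `PoloidalWindowRigidity` = stmt-NavierStokesRegularity-19708;
line `mixed_type` v1; item stmt-20428 `LrcModEntire`).  File 2 of the Lean port of **Theorem A** of memo
TH-ELLIPTIC-LIOUVILLE-g6 (semi-elliptic (TH) Liouville without slope bounds; file 1 = `…VerticalConvexity`, the 1-D core).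
The core consumes, at every height, an «integration-by-parts inequality with the weight's error»
`∫ u·lap·ρ ≤ −∫ |∇ₕu|²ρ + δ ∫ |u| |∇ₕu| ρ`.  This file supplies it on a finite-dimensional real inner product space `E`
(the horizontal plane in the application) for the weight

  `ρ_σ(x) = ((1 + ‖x‖²/σ²)²)⁻¹`,   `σ > 0`,

which is smooth, `0 < ρ_σ ≤ 1`, satisfies the KEY GRADIENT BOUND `|Dρ_σ(x)v| ≤ (2/σ) ρ_σ(x) ‖v‖` (so `δ = 2/σ` can be made small —
this is why a polynomial weight is used rather than a cut-off), and is integrable when `dim E < 4`: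

* `weight`, `weight_pos`, `weight_le_one`, `contDiff_weight`, `hasFDerivAt_weight`, `abs_fderiv_weight_le` (the `2/σ` bound),
  `integrable_weight` (`finrank E < 4`);
* `integral_mul_divGrad_mul_weight_le` — **THE WEIGHTED IBP INEQUALITY**: for `f ∈ C²(E)` with `f`, `∇f`, `div ∇f` bounded,
  `∫ f · div(∇f) · ρ_σ ≤ −∫ ‖∇f‖² ρ_σ + (2/σ) ∫ |f| ‖∇f‖ ρ_σ`
  (whole-space divergence theorem `…PineauVicol2026.integral_divergence_eq_zero_of_integrable_div` applied to `F = (f ρ_σ) ∇f`,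
  whose flux `‖F‖/(1+|x|) ≤ K²ρ_σ` and divergence `f ρ_σ div∇f + ρ_σ‖∇f‖² + f Dρ_σ(∇f)` are integrable).

WHAT THIS IS NOT: not a claim about Navier–Stokes — weighted calculus on `ℝᵈ` (bears_on LADDER-NS N0 via crux K2 = stmt-19708 /
item 20428: Theorem A closes `stub_semiElliptic` ∩ (TH) and makes `stub_twistingTH` hyperbolic WLOG).
-/

-- the summit and its single sub-problem share the name (CONVENTIONS §1)
set_option linter.dupNamespace false

noncomputable section

namespace Summit.NavierStokesRegularity.NavierStokesRegularity.Theorems.PoloidalWindowDoorPoloidalWindowRigidityWeightedIBP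

open Set Function Filter Topology MeasureTheory InnerProductSpace
open scoped RealInnerProductSpace
open Literature.Analysis.FluidPDE

variable {E : Type*} [NormedAddCommGroup E]

/-! ### The weight -/

/-- The polynomial weight `ρ_σ(x) = ((1 + ‖x‖²/σ²)²)⁻¹`. [folklore] -/
def weight (σ : ℝ) (x : E) : ℝ := ((1 + ‖x‖ ^ 2 / σ ^ 2) ^ 2)⁻¹

/-- The base `1 + ‖x‖²/σ²` is `≥ 1`. -/
theorem one_le_weightBase (σ : ℝ) (x : E) : 1 ≤ 1 + ‖x‖ ^ 2 / σ ^ 2 := by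
  have : 0 ≤ ‖x‖ ^ 2 / σ ^ 2 := by positivity
  linarith

/-- The base is positive. -/
theorem weightBase_pos (σ : ℝ) (x : E) : 0 < 1 + ‖x‖ ^ 2 / σ ^ 2 :=
  lt_of_lt_of_le one_pos (one_le_weightBase σ x)

/-- `ρ_σ > 0`. [folklore] -/
theorem weight_pos (σ : ℝ) (x : E) : 0 < weight σ x := by
  unfold weight
  exact inv_pos.2 (pow_pos (weightBase_pos σ x) 2)

/-- `ρ_σ ≤ 1`. [folklore] -/
theorem weight_le_one (σ : ℝ) (x : E) : weight σ x ≤ 1 := by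
  unfold weight
  have h1 : 1 ≤ (1 + ‖x‖ ^ 2 / σ ^ 2) ^ 2 := one_le_pow₀ (one_le_weightBase σ x)
  exact inv_le_one_of_one_le₀ h1

/-- `|ρ_σ| = ρ_σ`. -/
theorem abs_weight (σ : ℝ) (x : E) : |weight σ x| = weight σ x := abs_of_pos (weight_pos σ x)

section Inner

variable [InnerProductSpace ℝ E]

/-- `ρ_σ` is smooth. [folklore] -/
theorem contDiff_weight {σ : ℝ} {n : WithTop ℕ∞} : ContDiff ℝ n (weight (E := E) σ) := by
  unfold weight
  have hb : ContDiff ℝ n fun x : E => (1 + ‖x‖ ^ 2 / σ ^ 2) ^ 2 :=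
    (contDiff_const.add ((contDiff_norm_sq ℝ).div_const _)).pow 2
  exact hb.inv fun x => (pow_pos (weightBase_pos σ x) 2).ne'

/-- `ρ_σ` is continuous. -/
theorem continuous_weight {σ : ℝ} : Continuous (weight (E := E) σ) := (contDiff_weight (n := 0)).continuous

/-- The derivative of `ρ_σ`: `Dρ_σ(x) v = −(4/σ²) (1 + ‖x‖²/σ²)⁻³ ⟪x, v⟫`. [folklore] -/
theorem hasFDerivAt_weight (σ : ℝ) (x : E) :
    HasFDerivAt (weight (E := E) σ)
      ((-(4 / σ ^ 2) * ((1 + ‖x‖ ^ 2 / σ ^ 2) ^ 3)⁻¹) • innerSL ℝ x) x := by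
  -- `ρ = h ∘ N` with `N x = ‖x‖²`, `h s = ((1 + s/σ²)²)⁻¹`
  have hN : HasFDerivAt (fun y : E => ‖y‖ ^ 2) ((2 : ℝ) • innerSL ℝ x) x := by
    have h := (hasStrictFDerivAt_norm_sq x).hasFDerivAt
    rw [← Nat.cast_smul_eq_nsmul ℝ] at h
    simpa using h
  set b : ℝ := 1 + ‖x‖ ^ 2 / σ ^ 2 with hb
  have hbpos : 0 < b := weightBase_pos σ x
  -- derivative of `s ↦ ((1 + s/σ²)²)⁻¹` at `s₀ = ‖x‖²`
  have h1 : HasDerivAt (fun s : ℝ => 1 + s / σ ^ 2) (1 / σ ^ 2) (‖x‖ ^ 2) := by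
    have := ((hasDerivAt_id (‖x‖ ^ 2)).div_const (σ ^ 2)).const_add 1
    simpa [one_div] using this
  have hm : HasDerivAt (fun s : ℝ => (1 + s / σ ^ 2) * (1 + s / σ ^ 2))
      (1 / σ ^ 2 * (1 + ‖x‖ ^ 2 / σ ^ 2) + (1 + ‖x‖ ^ 2 / σ ^ 2) * (1 / σ ^ 2)) (‖x‖ ^ 2) := h1.mul h1
  have h2 : HasDerivAt (fun s : ℝ => (1 + s / σ ^ 2) ^ 2) (2 * b * (1 / σ ^ 2)) (‖x‖ ^ 2) := by
    have e : (fun s : ℝ => (1 + s / σ ^ 2) ^ 2) = fun s => (1 + s / σ ^ 2) * (1 + s / σ ^ 2) :=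
      funext fun s => sq _
    rw [e]
    exact hm.congr_deriv (by rw [hb]; ring)
  have hg : HasDerivAt (fun s : ℝ => ((1 + s / σ ^ 2) ^ 2)⁻¹)
      (-(2 * b * (1 / σ ^ 2)) / ((1 + ‖x‖ ^ 2 / σ ^ 2) ^ 2) ^ 2) (‖x‖ ^ 2) := h2.inv (pow_pos hbpos 2).ne'
  have hcomp := hg.comp_hasFDerivAt x hN
  rw [smul_smul] at hcomp
  have e : -(2 * b * (1 / σ ^ 2)) / ((1 + ‖x‖ ^ 2 / σ ^ 2) ^ 2) ^ 2 * (2 : ℝ) =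
      -(4 / σ ^ 2) * ((1 + ‖x‖ ^ 2 / σ ^ 2) ^ 3)⁻¹ := by
    rw [hb]
    field_simp
    ring
  rw [← e]
  exact hcomp

/-- **The key gradient bound** `|Dρ_σ(x) v| ≤ (2/σ) ρ_σ(x) ‖v‖` for `σ > 0`
(`(4|x|/σ²)/(1 + |x|²/σ²) ≤ 2/σ` because `2t ≤ 1 + t²`). [folklore] -/
theorem abs_fderiv_weight_le {σ : ℝ} (hσ : 0 < σ) (x v : E) :
    |fderiv ℝ (weight (E := E) σ) x v| ≤ 2 / σ * weight σ x * ‖v‖ := by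
  rw [(hasFDerivAt_weight σ x).fderiv]
  set b : ℝ := 1 + ‖x‖ ^ 2 / σ ^ 2 with hb
  have hbpos : 0 < b := weightBase_pos σ x
  simp only [_root_.FunLike.coe_smul, Pi.smul_apply, innerSL_apply_apply, smul_eq_mul]
  have hρ : weight σ x = (b ^ 2)⁻¹ := rfl
  rw [hρ, abs_mul, abs_mul, abs_inv, abs_of_pos (pow_pos hbpos 3), abs_neg, abs_of_pos (by positivity : (0:ℝ) < 4 / σ ^ 2)]
  have hin : |⟪x, v⟫| ≤ ‖x‖ * ‖v‖ := abs_real_inner_le_norm x v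
  -- reduce to `(4/σ²) ‖x‖ / b³ ≤ (2/σ)/b²`, i.e. `2 ‖x‖/σ ≤ b = 1 + ‖x‖²/σ²`
  have hkey : 4 / σ ^ 2 * (b ^ 3)⁻¹ * ‖x‖ ≤ 2 / σ * (b ^ 2)⁻¹ := by
    rw [show 4 / σ ^ 2 * (b ^ 3)⁻¹ * ‖x‖ = (2 / σ * (b ^ 2)⁻¹) * ((2 * (‖x‖ / σ)) / b) by
      field_simp; ring]
    refine mul_le_of_le_one_right (by positivity) ?_
    rw [div_le_one hbpos, hb]
    have hsq : 0 ≤ (‖x‖ / σ - 1) ^ 2 := sq_nonneg _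
    have : ‖x‖ ^ 2 / σ ^ 2 = (‖x‖ / σ) ^ 2 := by rw [div_pow]
    rw [this]
    nlinarith
  calc 4 / σ ^ 2 * (b ^ 3)⁻¹ * |⟪x, v⟫|
      ≤ 4 / σ ^ 2 * (b ^ 3)⁻¹ * (‖x‖ * ‖v‖) := mul_le_mul_of_nonneg_left hin (by positivity)
    _ = (4 / σ ^ 2 * (b ^ 3)⁻¹ * ‖x‖) * ‖v‖ := by ring
    _ ≤ (2 / σ * (b ^ 2)⁻¹) * ‖v‖ := mul_le_mul_of_nonneg_right hkey (norm_nonneg _)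

end Inner

section Integrable

variable [InnerProductSpace ℝ E] [FiniteDimensional ℝ E] [MeasurableSpace E] [BorelSpace E]

omit [InnerProductSpace ℝ E] [FiniteDimensional ℝ E] [MeasurableSpace E] [BorelSpace E] in
/-- `ρ_σ ≤ (1 ∨ σ²)² · (1 + ‖x‖²)⁻²`: comparison with the standard Japanese-bracket weight. -/
theorem weight_le_mul_japanese {σ : ℝ} (hσ : 0 < σ) (x : E) :
    weight σ x ≤ (max 1 (σ ^ 2)) ^ 2 * ((1 : ℝ) + ‖x‖ ^ 2) ^ (-(4 : ℝ) / 2) := by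
  set m : ℝ := max 1 (σ ^ 2) with hm
  have hm1 : 1 ≤ m := le_max_left _ _
  have hmσ : σ ^ 2 ≤ m := le_max_right _ _
  have hσ2 : 0 < σ ^ 2 := by positivity
  have hJ : 0 < (1 : ℝ) + ‖x‖ ^ 2 := by positivity
  -- `(1 + ‖x‖²) ≤ m (1 + ‖x‖²/σ²)`
  have hcmp : 1 + ‖x‖ ^ 2 ≤ m * (1 + ‖x‖ ^ 2 / σ ^ 2) := by
    rw [mul_add, mul_one, mul_div_assoc']
    have h1 : ‖x‖ ^ 2 ≤ m * ‖x‖ ^ 2 / σ ^ 2 := by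
      rw [le_div_iff₀ hσ2]
      nlinarith [sq_nonneg ‖x‖]
    linarith
  have hrpow : ((1 : ℝ) + ‖x‖ ^ 2) ^ (-(4 : ℝ) / 2) = ((1 + ‖x‖ ^ 2) ^ 2)⁻¹ := by
    rw [show (-(4 : ℝ) / 2) = -(2 : ℝ) by norm_num, Real.rpow_neg hJ.le, Real.rpow_two]
  rw [hrpow, weight]
  have hb := weightBase_pos σ x
  have hsq : (1 + ‖x‖ ^ 2) ^ 2 ≤ m ^ 2 * (1 + ‖x‖ ^ 2 / σ ^ 2) ^ 2 := by
    have := pow_le_pow_left₀ hJ.le hcmp 2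
    rwa [mul_pow] at this
  rw [inv_eq_one_div, inv_eq_one_div, mul_one_div, div_le_div_iff₀ (pow_pos hb 2) (pow_pos hJ 2), one_mul]
  exact hsq

/-- `ρ_σ` is integrable when `dim E < 4`. [folklore] -/
theorem integrable_weight {σ : ℝ} (hσ : 0 < σ) (hE : Module.finrank ℝ E < 4) :
    Integrable (weight (E := E) σ) := by
  have hJ : Integrable (fun x : E => ((1 : ℝ) + ‖x‖ ^ 2) ^ (-(4 : ℝ) / 2)) :=
    integrable_rpow_neg_one_add_norm_sq (μ := volume) (by exact_mod_cast hE)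
  refine (hJ.const_mul ((max 1 (σ ^ 2)) ^ 2)).mono' continuous_weight.aestronglyMeasurable
    (Eventually.of_forall fun x => ?_)
  rw [Real.norm_eq_abs, abs_weight]
  exact weight_le_mul_japanese hσ x

end Integrable

/-! ### The weighted integration-by-parts inequality -/

section IBP

variable [InnerProductSpace ℝ E] [FiniteDimensional ℝ E] [MeasurableSpace E] [BorelSpace E]

omit [MeasurableSpace E] [BorelSpace E] in
/-- `C¹` gradient of a `C²` function. [folklore] -/
theorem contDiff_one_gradient {f : E → ℝ} (hf : ContDiff ℝ 2 f) : ContDiff ℝ 1 (gradient f) := by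
  haveI : CompleteSpace E := FiniteDimensional.complete ℝ E
  have e1 : gradient f = fun y => (toDual ℝ E).symm (fderiv ℝ f y) := rfl
  rw [e1]
  exact (toDual ℝ E).symm.toContinuousLinearEquiv.contDiff.comp (hf.fderiv_right (m := 1) (by norm_num))

/-- A continuous function dominated by a multiple of `ρ_σ` is integrable (`dim E < 4`). -/
theorem integrable_of_le_weight {σ : ℝ} (hσ : 0 < σ) (hE : Module.finrank ℝ E < 4) {h : E → ℝ}
    (hc : Continuous h) {K : ℝ} (hK : ∀ x, |h x| ≤ K * weight σ x) : Integrable h :=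
  ((integrable_weight hσ hE).const_mul K).mono' hc.aestronglyMeasurable
    (Eventually.of_forall fun x => by rw [Real.norm_eq_abs]; exact hK x)

/-- **THE WEIGHTED IBP INEQUALITY.**  Let `dim E < 4`, `σ > 0`, and `f ∈ C²(E)` with `|f| ≤ K`, `‖∇f‖ ≤ K`,
`|div ∇f| ≤ K`.  Then
`∫ f · div(∇f) · ρ_σ ≤ −∫ ‖∇f‖² ρ_σ + (2/σ) ∫ |f| ‖∇f‖ ρ_σ`.
Proof: the `C¹` field `F = (f ρ_σ) ∇f` has `‖F‖/(1+|x|) ≤ K² ρ_σ` and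
`div F = f ρ_σ div∇f + ρ_σ ‖∇f‖² + f Dρ_σ(∇f)` integrable, so `∫ div F = 0` (tree, whole-space divergence theorem with
integrable flux), and `|f Dρ_σ(∇f)| ≤ (2/σ)|f| ‖∇f‖ ρ_σ`. [folklore] -/
theorem integral_mul_divGrad_mul_weight_le {σ : ℝ} (hσ : 0 < σ) (hE : Module.finrank ℝ E < 4)
    {f : E → ℝ} (hf : ContDiff ℝ 2 f) {K : ℝ} (hfK : ∀ x, |f x| ≤ K) (hgK : ∀ x, ‖gradient f x‖ ≤ K)
    (hdK : ∀ x, |VectorCalculus.divergence (gradient f) x| ≤ K) :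
    ∫ x, f x * VectorCalculus.divergence (gradient f) x * weight σ x ≤
      -(∫ x, ‖gradient f x‖ ^ 2 * weight σ x) + 2 / σ * ∫ x, |f x| * ‖gradient f x‖ * weight σ x := by
  haveI : CompleteSpace E := FiniteDimensional.complete ℝ E
  have hK : 0 ≤ K := (abs_nonneg _).trans (hfK 0)
  -- the field and its regularity
  set ρ : E → ℝ := weight σ with hρ
  set F : E → E := fun x => (f x * ρ x) • gradient f x with hF
  have hρc : ContDiff ℝ 2 ρ := contDiff_weight
  have hg1 : ContDiff ℝ 1 (gradient f) := contDiff_one_gradient hf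
  have hF1 : ContDiff ℝ 1 F := ((hf.of_le (by norm_num)).mul (hρc.of_le (by norm_num))).smul hg1
  have hfd : ∀ x, DifferentiableAt ℝ f x := fun x => hf.differentiable (by norm_num) x
  have hρd : ∀ x, DifferentiableAt ℝ ρ x := fun x => hρc.differentiable (by norm_num) x
  have hgd : ∀ x, DifferentiableAt ℝ (gradient f) x := fun x => hg1.differentiable (by norm_num) x
  -- divergence of `F`
  have hdiv : ∀ x, VectorCalculus.divergence F x =
      f x * VectorCalculus.divergence (gradient f) x * ρ x + ‖gradient f x‖ ^ 2 * ρ x +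
        f x * fderiv ℝ ρ x (gradient f x) := by
    intro x
    have hθ : DifferentiableAt ℝ (fun y => f y * ρ y) x := (hfd x).mul (hρd x)
    rw [hF, divergence_smul_apply (θ := fun y => f y * ρ y) (u := gradient f) hθ (hgd x),
      inner_gradient_right_eq_fderiv (θ := fun y => f y * ρ y), fderiv_fun_mul (hfd x) (hρd x)]
    simp only [_root_.add_apply, _root_.FunLike.coe_smul, Pi.smul_apply, smul_eq_mul]
    rw [← inner_gradient_right_eq_fderiv (θ := f), real_inner_self_eq_norm_sq]
    ring
  -- pointwise bounds by multiples of `ρ`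
  have hρ0 : ∀ x, 0 < ρ x := weight_pos σ
  have b1 : ∀ x, |f x * VectorCalculus.divergence (gradient f) x * ρ x| ≤ K * K * ρ x := fun x => by
    rw [abs_mul, abs_mul, abs_of_pos (hρ0 x)]
    exact mul_le_mul_of_nonneg_right (mul_le_mul (hfK x) (hdK x) (abs_nonneg _) hK) (hρ0 x).le
  have b2 : ∀ x, |‖gradient f x‖ ^ 2 * ρ x| ≤ K ^ 2 * ρ x := fun x => by
    rw [abs_mul, abs_of_pos (hρ0 x), abs_pow, abs_norm]
    exact mul_le_mul_of_nonneg_right (pow_le_pow_left₀ (norm_nonneg _) (hgK x) 2) (hρ0 x).le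
  have b3 : ∀ x, |f x * fderiv ℝ ρ x (gradient f x)| ≤ 2 / σ * |f x| * ‖gradient f x‖ * ρ x := fun x => by
    rw [abs_mul]
    have := abs_fderiv_weight_le hσ x (gradient f x)
    calc |f x| * |fderiv ℝ ρ x (gradient f x)| ≤ |f x| * (2 / σ * weight σ x * ‖gradient f x‖) :=
          mul_le_mul_of_nonneg_left this (abs_nonneg _)
      _ = 2 / σ * |f x| * ‖gradient f x‖ * ρ x := by rw [hρ]; ring
  have b3' : ∀ x, |f x * fderiv ℝ ρ x (gradient f x)| ≤ 2 / σ * K * K * ρ x := fun x =>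
    (b3 x).trans (by
      have h1 : |f x| * ‖gradient f x‖ ≤ K * K := mul_le_mul (hfK x) (hgK x) (norm_nonneg _) hK
      have h2σ : 0 ≤ 2 / σ := by positivity
      calc 2 / σ * |f x| * ‖gradient f x‖ * ρ x = 2 / σ * (|f x| * ‖gradient f x‖) * ρ x := by ring
        _ ≤ 2 / σ * (K * K) * ρ x :=
          mul_le_mul_of_nonneg_right (mul_le_mul_of_nonneg_left h1 h2σ) (hρ0 x).le
        _ = 2 / σ * K * K * ρ x := by ring)
  -- continuity of the three pieces
  have c_div : Continuous (VectorCalculus.divergence (gradient f)) :=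
    continuous_divergence (hg1.continuous_fderiv one_ne_zero)
  have c_g : Continuous (gradient f) := hg1.continuous
  have c1 : Continuous fun x => f x * VectorCalculus.divergence (gradient f) x * ρ x :=
    (hf.continuous.mul c_div).mul hρc.continuous
  have c2 : Continuous fun x => ‖gradient f x‖ ^ 2 * ρ x := (c_g.norm.pow 2).mul hρc.continuous
  have c3 : Continuous fun x => f x * fderiv ℝ ρ x (gradient f x) :=
    hf.continuous.mul ((hρc.continuous_fderiv (by norm_num)).clm_apply c_g)
  have c4 : Continuous fun x => |f x| * ‖gradient f x‖ * ρ x := (hf.continuous.abs.mul c_g.norm).mul hρc.continuous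
  -- integrability
  have i1 : Integrable fun x => f x * VectorCalculus.divergence (gradient f) x * ρ x :=
    integrable_of_le_weight hσ hE c1 b1
  have i2 : Integrable fun x => ‖gradient f x‖ ^ 2 * ρ x := integrable_of_le_weight hσ hE c2 b2
  have i3 : Integrable fun x => f x * fderiv ℝ ρ x (gradient f x) := integrable_of_le_weight hσ hE c3 b3'
  have i4 : Integrable fun x => |f x| * ‖gradient f x‖ * ρ x :=
    integrable_of_le_weight hσ hE c4 (K := K * K) fun x => by
      rw [abs_mul, abs_mul, abs_abs, abs_norm, abs_of_pos (hρ0 x)]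
      exact mul_le_mul_of_nonneg_right (mul_le_mul (hfK x) (hgK x) (norm_nonneg _) hK) (hρ0 x).le
  -- flux and divergence integrability for the divergence theorem
  have hflux : Integrable fun x => ‖F x‖ / (1 + ‖x‖) := by
    refine integrable_of_le_weight hσ hE (K := K * K) ?_ fun x => ?_
    · exact (hF1.continuous.norm).div (continuous_const.add continuous_norm) fun x => by positivity
    · rw [abs_div, abs_norm, abs_of_pos (by positivity : (0:ℝ) < 1 + ‖x‖)]
      have hFn : ‖F x‖ ≤ K * K * ρ x := by
        rw [hF]
        simp only [norm_smul, Real.norm_eq_abs, abs_mul, abs_of_pos (hρ0 x)]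
        calc |f x| * ρ x * ‖gradient f x‖ = |f x| * ‖gradient f x‖ * ρ x := by ring
          _ ≤ K * K * ρ x := mul_le_mul_of_nonneg_right
              (mul_le_mul (hfK x) (hgK x) (norm_nonneg _) hK) (hρ0 x).le
      calc ‖F x‖ / (1 + ‖x‖) ≤ ‖F x‖ := div_le_self (norm_nonneg _) (by linarith [norm_nonneg x])
        _ ≤ K * K * ρ x := hFn
  have hdivI : Integrable fun x => VectorCalculus.divergence F x := by
    have : (fun x => VectorCalculus.divergence F x) = fun x =>
        f x * VectorCalculus.divergence (gradient f) x * ρ x + ‖gradient f x‖ ^ 2 * ρ x +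
          f x * fderiv ℝ ρ x (gradient f x) := funext hdiv
    rw [this]
    exact (i1.add i2).add i3
  -- `∫ div F = 0`
  have h0 := PineauVicol2026.integral_divergence_eq_zero_of_integrable_div hF1 hflux hdivI
  have i12 : Integrable fun x =>
      f x * VectorCalculus.divergence (gradient f) x * ρ x + ‖gradient f x‖ ^ 2 * ρ x := i1.add i2
  rw [show (fun y => VectorCalculus.divergence F y) = fun x =>
      f x * VectorCalculus.divergence (gradient f) x * ρ x + ‖gradient f x‖ ^ 2 * ρ x +
        f x * fderiv ℝ ρ x (gradient f x) from funext hdiv,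
    integral_add i12 i3, integral_add i1 i2] at h0
  -- the error term
  have herr : -(∫ x, f x * fderiv ℝ ρ x (gradient f x)) ≤ 2 / σ * ∫ x, |f x| * ‖gradient f x‖ * ρ x := by
    rw [← integral_const_mul, ← integral_neg]
    refine integral_mono i3.neg (i4.const_mul _) fun x => ?_
    have := (neg_le_abs _).trans (b3 x)
    simpa [mul_assoc] using this
  have : ∫ x, f x * VectorCalculus.divergence (gradient f) x * ρ x =
      -(∫ x, ‖gradient f x‖ ^ 2 * ρ x) + -(∫ x, f x * fderiv ℝ ρ x (gradient f x)) := by linarith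
  rw [this]
  linarith

end IBP

end Summit.NavierStokesRegularity.NavierStokesRegularity.Theorems.PoloidalWindowDoorPoloidalWindowRigidityWeightedIBP
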